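import Summits.BirchSwinnertonDyer.Rank1Residual.F1Sign2.ThetaDiscrepancyParityAtTwo
import Literature.NumberTheory.QuadraticForms.HilbertReciprocityRat
import HarnessLib

/-!
# Cell `bsd-f1-sign2`, lens `-desc` g13 (MEMO-desc §21): the LOCAL GAUGE of the `2`-Selmer parity-transfer law along a `2`-congruence,
# PRINT-ANCHORED on Green–Maistret 2022 (Def. 2.8 / Thm. 2.11 / Lemma 6.3) — DESC-§21-G (LEAD), DESC-§21-R, DESC-§21-N, DESC-§21-D

STATEMENTS ONLY: carriers WITH BODIES (`gmCurve`, `gmPartner`, `gmL`, `gmDisc`, `gmGaugeAt`, `gmGaugeInfty`, `IsGMCongruence`) and four plain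
`def … : Prop` rows (G conjecture-grade candidate; R, N theorem-grade on paper; D folklore support) — theorem-CANDIDATES, not `@[conjecture]`-tagged
obligations of a route, nothing asserted; every §20 carrier (`thetaDiscrepancyAtTwo`, `IsLocalParitySymbolAt`, `InTransportedKummerImageAtTwo`,
`InRealKummerImageAtTwo`, …) is IMPORTED from the landed `F1Sign2/ThetaDiscrepancyParityAtTwo.lean` (p610974), nothing restated; plus a SUPPORT
section of PROVED lemmas about the new carriers only (the six `b`-invariants, the two `u`-cubics, and NON-VACUITY OF THE PIN `exists_isGMCongruence`
— REF1 §83 rider g3, text from REF1's kernel-clean probe); no `instance`, no `notation`, no named Literature fact, no `sorry`.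

TYPER FILING (seat `bsd-f1-sign2-ty` g8; CANDIDATES.md rows DESC-§21-G / -R / -N / -D; -desc g13 CANDIDATES-delta 2026-08-28T07:30:35Z, D-desc-ty-21
«file as `F1Sign2/CongruenceLocalGaugeAtTwo.lean` = Sketch-v17 body when -ref1 clears»; REF1 §83 FILING GATE 08:18:24Z): definition bodies VERBATIM from
`HOME/MEMO-desc-data/g13/lean/Sketch-v17.lean` 8232c8c772f67c4e (-desc: farm rc 0 · 0 err · 0 warn · 0 sorry; BC7 `Probe-v17.out` 7868870fc0c5c632 4/4
CLEAN); support theorems VERBATIM from `HOME/REF1-data/b83/Probe83.lean` cf126a14c971e026 l.137–197 (docstrings added) — builder `tools/mk_desc21.py`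
(published with the filed text under `HOME/MEMO-ty-data/g8/`) applies: this header; bib keys normalised to `references.bib` (`DokchitserDokchitser2011` ↦
`DokchitserDokchitser2011Crelle`; Poonen–Rains locator in the arXiv:1009.0287 numbering used by the §20 file, Thm. 4.13; `AhmedAribamShekhar2017` ADDED
(JNT 177 (2017) 285–306 = arXiv:1608.08078); `Nekovar2013` = ANT 7 (2013) present); REF1 and REF2 riders folded into the four docstrings.
REF1-AUDIT-v1 §83 (2026-08-28T08:18:24Z, D-desc-ref1-21; evidence `HOME/REF1-data/b83/`: Probe83.lean cf126a14c971e026 = this body VERBATIM on the landed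
carriers + audit lemmas e1–e8, farm rc 0 · 0 err · 0 warn · 0 sorry; polycheck.py, lincomb.py symbolic certificates; GM 2022 read first-hand): **G
`CongruenceLocalGaugeIsGreenMaistretAtTwo` SURVIVES conjecture-grade (census-exact), CLEARED for filing as typed; R `RealCongruenceParityIsGreenMaistretAtTwo`
SURVIVES theorem-grade on paper (GM Prop. 3.2 cases 1–6 re-read against the κ_∞ table), CLEARED; N `CongruenceParityAtNodalPrimeAtTwo` SURVIVES
theorem-candidate, CLEARED — N = G restricted to d = 1 and the simple nodal primes EXACTLY (derivation in N's docstring); D `DiscProductSquareOfTwoCongruence`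
TRUE (elementary), CLEARED as support.** -desc's five questions answered YES: (i) the guard `localRootNumberAt v ≠ 0` = the tree's junk branch, necessary and
self-lifting; (ii) the pin `IsGMCongruence` is SATISFIABLE for every (a,b,c,d) — `exists_isGMCongruence` PROVED (kernel, axioms trio; included below as
support, rider g3) — and ψ-DETERMINING whenever c_E is irreducible; (iii) the (d_p,c_p), (d_∞,c_∞) binders reuse the landed §20-P pattern symbol for
symbol; (iv) `IsSquare ((b:ℤ) : ZMod p)` under p ∤ b = (b/p) = +1 = split node, `padicValInt p c` right; (v) real closed form = GM Prop. 3.2. Consistency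
(A5 β): G at all primes ∧ R at ∞ ⇒ (−1)^{Σκ_v} w(E)w(F) = Π(−1,−1)_v · Π𝓔_v · Π(d,−Δ_f)_v = 1 by Hilbert reciprocity per symbol = the landed DESC-§20-W
⟺ §20-P mod Monsky — the termwise law refines and cannot contradict the landed global rows. BC7: REF1 could not recompute κ_v on the hub (no PARI/Sage);
the census numbers are -desc's (two oracles per row); REF1's independent checks are the algebraic skeleton (e1/e2/e8 normal form ↔ tree models, e3 pin,
Def. 2.8 transcription, N ⟸ G, global product). Riders g1 (guard sentence), g2 (coverage gap, census paragraph), g3 (support theorems), g4 (N derivation),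
d1 (disc c_W = 2⁸·Δ_W) — all folded below. PARTITION: none; beyond-print theorem: no; BSD is NOT proved by any of this.
REF2-PLACEMENT-v19 §2 (32860752047f3695, 2026-08-28T07:58:13Z, D-desc-ref2-21 + addendum j302686): **G = NOT IN PRINT at p = 2, NEW-COMBINATION** (levers each
pulled in print on parity-under-congruence: termwise Selmer-vs-root-number comparison under a mod-p congruence at ODD p — Ahmed–Aribam–Shekhar JNT 2017
Thms 1.1–1.4, Nekovář ANT 2013 (MR arithmetic local constants, «when p is odd»); the (2,2)-isogeny local term at 2 — GM 2022 Thm 2.11, DM 2023; Lagrangian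
parity bookkeeping at 2 — PR 2012 Thm 4.13, KMR 2013 Thm 3.9 — joined at p = 2 for NON-TWIST congruences with the constant cocycle (−1,−1)_v as the one
element in none of them; not VARIANT — no printed p = 2 descent-side symbol exists to re-parametrise; not new-mechanism); at p = 2 the 2-Selmer side of a
bare congruence appears in print only as MR Selmer companions, which at 2 need the congruence one level up (m = 2^{k+1}); GM print the gap verbatim
(«finding the correct local discrepancy … very challenging due to the current lack of a conceptual understanding», arXiv 2110.06718 p. 14). **R = sub-row of
G, VARIANT**, theorem-candidate by sign chase (GM Prop 3.2 λ_ℝ = 𝓔_ℝ); **N = theorem-candidate on printed ingredients (Kramer 1981 Props 1, 2, 7; Tate-curve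
Kummer theory), VARIANT — the right first rung**; **D = KNOWN, folklore** (isomorphic irreducible cubic étale algebras ⇒ Δ_EΔ_F ∈ ℚ^{×2}). Proof currency
(Q2): the Dokchitser–Dokchitser §4 global-to-local deformation IS the printed currency for such identities in residue characteristic 2 — GM prove Local Thm
2.11 over 𝒦/ℚ₂ exactly so (GM §6; they needed cluster pictures, not just Kramer Props 1–2, for the semistable odd strata). A direct cohomological
identification of (−1,−1)_v in this role: NOT FOUND (corpus hybrid, vec; galaxy); nearest objects PR 2011 self-cup, PR12 Rem 4.3 obstruction class, Weil
index γ(q) ∈ μ₈ — never tied to 2-Selmer Lagrangians of congruent curves in print; no normalisation artefact produces a constant sign at exactly {2, ∞}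
(the cocycle survived j302686's 345 035 rows) — keep (−1,−1)_v as an honest census constant and cite GM §7 for «no conceptual identification known».
PARTITION: none; beyond-print theorem: no (G, R census-exact conjecture rows; N candidate).
CENSUS / BC5 (-desc g13; kit tag bsd-frontier-data): **j302066** (12 cores, 159 s; `engine5.gp` d09125ae830406b4, two square-class oracles agreeing
on every row; GM matcher with exact `j` / `r_ψ²` checks 3 692/3 692 / 4 000/4 000): 16 673 normal-form pairs — DESC-§21-G: **70 870 finite place rows,
0 violations** (+ addendum **j302686**: 345 035 place rows, 0 violations; 𝔽₂-fit unique solution (−1,−1)_v); DESC-§21-R: 16 673/16 673 at `∞`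
(`MEMO-desc-data/g13/an/realtable.txt`); DESC-§21-N: 17 612/17 612 nodal rows; closed forms recorded for -imc (D-desc-imc-21): κ_∞ = 1 iff three real
roots ∧ [(d > 0 ∧ ≥ 2 negative roots) ∨ (d < 0 ∧ ≤ 1)]; (−1)^{κ₂} = −λ_{f,2}·(−1)^{i₂}; odd mult–mult with both v_p(Δ) odd: κ_p = 0 (5 412/5 412).
REF2 v17 §11's Outcome A/B test came out NEITHER: the descent local term equals the (2,2)-isogeny term times (−1,−1)_v TERMWISE. Cheapest falsifier of
G: one normal-form pair and prime with the sign identity failing → 0/70 870 (0/345 035) → NOT KILLED. COVERAGE GAP (REF1 §83 rider g2, the cheapest NEXT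
falsifier, not yet run at filing): the 3 + 21 generated pairs in which (E′_{f_r})^{(d)} is a quadratic twist of E itself were EXCLUDED (mode tw), but G as
typed still CLAIMS them with ψ = ψ_GM, which is then NOT the twist identification (possible only on cyclic-cubic 2-division fields) — run the GM-mode
symbol on exactly those 24 pairs (seconds; ask D-ty-desc-21 to -desc). **CLOSED 2026-08-28T08:59:30Z (-desc g14, kit j304246, tag bsd-frontier-data,
16 cores, 67 s; `HOME/MEMO-desc-data/g14/job8/`, CENSUS8A.txt 8e9e26486908a2e5): C3 fields with ψ PINNED to the ψ_GM of `IsGMCongruence` — all 89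
cyclic-cubic-field curves × r ∈ {0, ±1} × d ∈ {1, −1, 2, −2, −3, 5, 6} = 1 869 GM pairs, law at ∞ 1 869/1 869, at 2 1 869/1 869, odd places 6 175/6 175,
0 violations, 0 errors (9 913 place rows); the excluded twist-coincidence pairs are exactly 196a1, 648b1, 1352b1 at r = 0 (non-CM; simplest cubics of
conductor 7, 9, 13), all on the law at every place under ψ_GM (∞ 21/21, 2 21/21, odd 28/28).** PARTITION: none moved; beyond-print theorem: no. bears_on: the cell's search
question (descent lens; the LOCAL GAUGE Q20.1 of MEMO-desc §20).

TEXT-ONLY FOLLOW-UP (typer g8, 2026-08-28 ≈09:10Z): REF1 §83 rider g2 coverage gap CLOSED by -desc g14 kit j304246 (census sentences in the G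
docstring); DESC-§21-D PROVED in `F1Sign2/CongruenceLocalGaugeAtTwoProofs.lean` (p619435). Declarations byte-identical to p616822.

Planner's summary (verbatim): Sketch-v17 (planner `-desc` g13, MEMO-desc §21): the LOCAL GAUGE of the `2`-Selmer parity-transfer law along a
`2`-congruence, PRINT-ANCHORED on Green–Maistret 2022 (arXiv 2110.06718, Def. 2.8 / Thm. 2.11 / Lemma 6.3)

§20 (Sketch-v15, g12) gave the GLOBAL law `s₂(E) + s₂(F) ≡ Σ_v κ_v(E,F;ψ)` with `κ_v = d_v + c_v` the local parity symbol of
the congruence (Kramer's term + the theta-discrepancy correction) and asked (Q20.1) for the LOCAL GAUGE: the sign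
`γ_v := (−1)^{κ_v}·w_v(E)·w_v(F)` is NOT `+1` termwise; what is it?  Green–Maistret normalise every non-twist `2`-congruent pair as
`E ≅ (y² = f(x))`, `F ≅ Jac(d y² = x f(x)) = (E′_f)^{(d)}`, `f = x³ + a x² + b x + c`, `c ≠ 0`, `E′_f : y² = x³ + b x² + ac x + c²`
(roots `c/αᵢ`), and prove TERMWISE `w_v(E) w_v(E′_f) = λ_{f,v}·𝓔_v(f)` with the explicit Hilbert-symbol gauge `𝓔` (Def. 2.8) and
`λ_{f,v}` the local term of the `(2,2)`-isogeny `E × E′_f → Jac(y² = f(x²))`.  CANDIDATE (DESC-§21-G, this file):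
`γ_v(E_f, (E′_f)^{(d)}) = (−1,−1)_v · 𝓔_v(f) · (d, −Δ_f)_v` at every place `v` — equivalently the `2`-DESCENT local term and the
`(2,2)`-ISOGENY local term agree at all odd places and differ by the constant sign `(−1,−1)_v` at `2` and `∞`:
`(−1)^{κ_v(E_f,E′_f)} = (−1,−1)_v · λ_{f,v}`.  Hand-verified at `v = ∞` in all six real root configurations (MEMO-desc §21.3);
census = BC5 witness (kit jobs of §21.5).  Carriers (`thetaDiscrepancyAtTwo`, `IsLocalParitySymbolAt`, `InTransportedKummerImageAtTwo`, `InRealKummerImageAtTwo`, …)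
are the tree's, from `F1Sign2/ThetaDiscrepancyParityAtTwo.lean` (landed p610974, `-ty` g7) — nothing is restated.  Statements only (`def … : Prop`); nothing asserted; no `sorry`; no `instance`; no new notation.
-/

noncomputable section

open scoped Classical TensorProduct

open WeierstrassCurve Polynomial NumberField IsDedekindDomain Literature.NumberTheory.QuadraticForms

namespace Summit.BirchSwinnertonDyer.Rank1Residual.F1Sign2

/-! ## New in g13: the Green–Maistret normal form of a `2`-congruence and its Hilbert-symbol gauge -/

/-- The curve `E_f : y² = f(x) = x³ + a x² + b x + c` of the Green–Maistret normal form. [cite: GreenMaistret2022, §2.1] -/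
def gmCurve (a b c : ℤ) : WeierstrassCurve ℚ := ⟨0, a, 0, b, c⟩

/-- The partner `E′_f : y² = x³ + b x² + a c x + c²`, a model of `Jac(y² = x f(x))` (roots `c/αᵢ`); `E_f[2] ≅ E′_f[2]` by
`αᵢ ↦ c/αᵢ`. [cite: GreenMaistret2022, Remark 2.2] -/
def gmPartner (a b c : ℤ) : WeierstrassCurve ℚ := ⟨0, b, 0, a * c, c ^ 2⟩

/-- `L = a b − 9 c`. [cite: GreenMaistret2022, Def. 2.8] -/
def gmL (a b c : ℤ) : ℤ := a * b - 9 * c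

/-- `Δ_f = 18abc − 4a³c + a²b² − 4b³ − 27c²`, the discriminant of `f`. [cite: GreenMaistret2022, Def. 2.8] -/
def gmDisc (a b c : ℤ) : ℤ := 18 * a * b * c - 4 * a ^ 3 * c + a ^ 2 * b ^ 2 - 4 * b ^ 3 - 27 * c ^ 2

/-- The Green–Maistret gauge at a prime `p`: `𝓔_p(f) = (b,−c)_p (−2L,Δ_f)_p (L,−b)_p` if `b, L ≠ 0`, else `(−c,−1)_p (2c,Δ_f)_p`
(Serre's explicit local signs `localSign p` = the Hilbert symbol of `ℚ_p`, `hilbertSymbol_rat_eq_localSign`).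
[cite: GreenMaistret2022, Def. 2.8] -/
def gmGaugeAt (p : ℕ) (a b c : ℤ) : ℤ :=
  if b ≠ 0 ∧ gmL a b c ≠ 0 then
    localSign p b (-c) * localSign p (-2 * gmL a b c) (gmDisc a b c) * localSign p (gmL a b c) (-b)
  else localSign p (-c) (-1) * localSign p (2 * c) (gmDisc a b c)

/-- The Green–Maistret gauge at the real place (`localSignInfty a b = (a,b)_ℝ`). [cite: GreenMaistret2022, Def. 2.8, Prop. 3.2] -/
def gmGaugeInfty (a b c : ℤ) : ℤ :=
  if b ≠ 0 ∧ gmL a b c ≠ 0 then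
    localSignInfty b (-c) * localSignInfty (-2 * gmL a b c) (gmDisc a b c) * localSignInfty (gmL a b c) (-b)
  else localSignInfty (-c) (-1) * localSignInfty (2 * c) (gmDisc a b c)

/-- The `2`-congruence of the normal form, as a `ℚ`-algebra map `ψ : L_F → L_E` for `E = E_f`, `F = (E′_f)^{(d)}`: the
`2`-division cubic of `E_f` has roots `θᵢ = 4αᵢ`, that of `(E′_f)^{(d)}` has roots `4 d c/αᵢ = 16 c d/θᵢ`, and `ψ` is the map
matching indices, i.e. `ψ(θ_F) · θ_E = 16 c d`. (For an irreducible cubic `L_E` is a field and this pins `ψ`.) -/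
def IsGMCongruence (a b c d : ℤ) (ψ : twoDivisionAlgebra ((gmPartner a b c).quadraticTwist (d : ℚ)) →ₐ[ℚ]
    twoDivisionAlgebra (gmCurve a b c)) : Prop :=
  ψ (twoDivisionRoot ((gmPartner a b c).quadraticTwist (d : ℚ))) * twoDivisionRoot (gmCurve a b c) =
    algebraMap ℚ (twoDivisionAlgebra (gmCurve a b c)) (16 * c * d : ℚ)

/-- **DESC-§21-G (LEAD CANDIDATE; conjecture-grade, census-exact — REF1-AUDIT §83 SURVIVES, CLEARED as typed; REF2 v19 §2: NOT IN PRINT at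
`p = 2`, NEW-COMBINATION; a plain def, nothing asserted).** THE LOCAL GAUGE OF THE
`2`-SELMER PARITY TRANSFER ALONG A `2`-CONGRUENCE, at the finite places.  For `a b c d : ℤ` with `c d ≠ 0`, `Δ_f ≠ 0`, both
`2`-division cubics irreducible, `E = E_f`, `F = (E′_f)^{(d)}` (by Green–Maistret Lemma 6.3 EVERY non-twist `2`-congruent pair over
`ℚ` with no rational `2`-torsion is of this form), `ψ` the congruence of the normal form, `p` a prime at which neither local root
number is the junk value `0` (i.e. neither curve is additive at `p ∈ {2, 3}`), and `(d_p, c_p)` the local parity symbol of §20: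
`(−1)^{d_p + c_p} · w_p(E) · w_p(F) = (−1,−1)_p · 𝓔_p(f) · (d, −Δ_f)_p`.
Equivalently (`p` odd): the `2`-descent local term equals the Green–Maistret `(2,2)`-isogeny local term times the Kramer–Tunnell
twist term; at `p = 2` they differ by the constant sign `−1` (compensated at `∞`, DESC-§21-R).  WHY IT MIGHT FAIL: a chain
(Maslov-type) defect of `κ` along `E ~ E′_f ~ F` for `d ≠ 1`; wild `2`-adic classes (`n₂ = 2`, `I_m^*`-pairs).  CENSUS (BC5 witness):
MEMO-desc §21.5 (j302066: 16 673 pairs, 70 870 finite place rows; j302686: 345 035 place rows; 0 violations).  GUARD (REF1 §83 rider g1): the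
hypothesis `localRootNumberAt v ≠ 0` is exactly the tree's documented junk branch (additive reduction in residue characteristic `2` or `3`,
`localRootNumber_of_hasAdditiveReduction_of_ringChar`); it is NECESSARY (with the junk value the equation would read `0 = ±1`) and SELF-LIFTING
(once Halberstadt's tables are transcribed the guard is vacuous and the statement extends by itself); at the guarded places the census law holds
with PARI's `w_p` (16 673/16 673 at `v = 2`); C3 fields with `ψ` pinned: kit j304246, 1 869 pairs / 9 913 place rows, 0 violations, including the
21 twist-coincidence pairs of REF1 §83 g2 (coverage gap closed, -desc g14 2026-08-28T08:59Z).  NEAREST PRIOR ART and NOVELTY (REF2 v19 §2): for ODD `p` the termwise comparison of `p`-Selmer data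
with root numbers under a mod-`p` congruence is in print (Ahmed–Aribam–Shekhar 2017 Thms 1.1–1.4; Nekovář 2013, MR arithmetic local constants, «when
`p` is odd»), and at `p = 2` only the isogeny, root-number side (Green–Maistret Thm. 2.11; Dokchitser–Maistret 2023) and Lagrangian bookkeeping for one
curve and its twists (Poonen–Rains, KMR) are printed; THIS termwise `2`-descent-side law for NON-TWIST `2`-congruences, with the constant cocycle
`(−1,−1)_v`, is NOT IN PRINT AT `p = 2` (new-combination; Green–Maistret §7 record «the current lack of a conceptual understanding» of such local
discrepancies; no cohomological identification of `(−1,−1)_v` in this role is known — it is an honest census constant here).  Proof currency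
(REF2 Q2): the Dokchitser–Dokchitser global-to-local deformation, as Green–Maistret prove Thm. 2.11 at `v ∣ 2`.
[cite: GreenMaistret2022, Def. 2.8, Thm. 2.11, Lemma 6.3, §6 (proof of Thm. 2.11 at v ∣ 2 by global-local), §7]
[cite: DokchitserDokchitser2011Crelle, §4 (global-to-local); Kramer–Tunnell theorem for quadratic twists (-desc cites Thm. 5)] [cite: Kramer1981, Thm. 1]
[cite: PoonenRains2012, Thm. 4.13 (arXiv:1009.0287 numbering)] [cite: AhmedAribamShekhar2017, Thms. 1.1–1.4 (odd p)] [cite: Nekovar2013, (odd p)] -/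
def CongruenceLocalGaugeIsGreenMaistretAtTwo : Prop :=
  ∀ (a b c d : ℤ), c ≠ 0 → d ≠ 0 → gmDisc a b c ≠ 0 →
    ∀ [Fact (Irreducible (twoDivisionUCubic (gmCurve a b c)))]
      [Fact (Irreducible (twoDivisionUCubic ((gmPartner a b c).quadraticTwist (d : ℚ))))]
      (ψ : twoDivisionAlgebra ((gmPartner a b c).quadraticTwist (d : ℚ)) →ₐ[ℚ] twoDivisionAlgebra (gmCurve a b c)),
      IsGMCongruence a b c d ψ →
    ∀ (p : ℕ) [Fact p.Prime] (v : HeightOneSpectrum ℤ), Rat.HeightOneSpectrum.natGenerator v = p →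
      (gmCurve a b c).localRootNumberAt v ≠ 0 → ((gmPartner a b c).quadraticTwist (d : ℚ)).localRootNumberAt v ≠ 0 →
    ∀ (dp cp : ℕ),
      IsLocalParitySymbolAt (gmCurve a b c) ℚ_[p] (InExplicitLocalKummerImageAtTwo (gmCurve a b c) p)
        (InTransportedKummerImageAtTwo (gmCurve a b c) ((gmPartner a b c).quadraticTwist (d : ℚ)) ψ p)
        (thetaDiscrepancyAtTwo (gmCurve a b c) ((gmPartner a b c).quadraticTwist (d : ℚ)) ψ) dp cp →
      (-1 : ℤ) ^ (dp + cp) * (gmCurve a b c).localRootNumberAt v * ((gmPartner a b c).quadraticTwist (d : ℚ)).localRootNumberAt v =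
        localSign p (-1) (-1) * gmGaugeAt p a b c * localSign p d (-(gmDisc a b c))

/-- **DESC-§21-R (theorem-grade; hand proof MEMO-desc §21.3, all six real root configurations).** THE REAL PLACE:
`(−1)^{d_∞ + c_∞} = −𝓔_ℝ(f) · (d, −Δ_f)_ℝ` (`w_∞(E) w_∞(F) = 1`, `(−1,−1)_ℝ = −1`).  For one real root `κ_∞ = 0` and `𝓔_ℝ(f)(d,−Δ_f)_ℝ
= −1`; for three real roots and `d > 0`: `κ_∞ = 1` iff at least two roots of `f` are negative.  REF1-AUDIT §83: SURVIVES theorem-grade on paper,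
CLEARED (`𝓔_ℝ = −1, −1, +1, +1` for `0, 1, 2, 3` negative roots and `−1` for one real root = GM Prop. 3.2 cases 1–6, matching the `κ_∞` table
`d > 0: 0,0,1,1`; `d < 0: 1,1,0,0`; one real root: `0`).  REF2 v19 §2: sub-row of G, VARIANT; theorem-candidate by sign chase.
[cite: GreenMaistret2022, Prop. 3.2] [cite: BrumerKramer1977, §2] -/
def RealCongruenceParityIsGreenMaistretAtTwo : Prop :=
  ∀ (a b c d : ℤ), c ≠ 0 → d ≠ 0 → gmDisc a b c ≠ 0 →
    ∀ [Fact (Irreducible (twoDivisionUCubic (gmCurve a b c)))]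
      [Fact (Irreducible (twoDivisionUCubic ((gmPartner a b c).quadraticTwist (d : ℚ))))]
      (ψ : twoDivisionAlgebra ((gmPartner a b c).quadraticTwist (d : ℚ)) →ₐ[ℚ] twoDivisionAlgebra (gmCurve a b c)),
      IsGMCongruence a b c d ψ →
    ∀ (d₀ c₀ : ℕ),
      IsLocalParitySymbolAt (gmCurve a b c) ℝ
        (InRealKummerImageAtTwo (gmCurve a b c) (twoDivisionUCubic (gmCurve a b c)) (twoDivisionRoot (gmCurve a b c)))
        (InRealKummerImageAtTwo (gmCurve a b c) (twoDivisionUCubic ((gmPartner a b c).quadraticTwist (d : ℚ)))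
          (ψ (twoDivisionRoot ((gmPartner a b c).quadraticTwist (d : ℚ)))))
        (thetaDiscrepancyAtTwo (gmCurve a b c) ((gmPartner a b c).quadraticTwist (d : ℚ)) ψ) d₀ c₀ →
      (-1 : ℤ) ^ (d₀ + c₀) = -(gmGaugeInfty a b c * localSignInfty d (-(gmDisc a b c)))

/-- **DESC-§21-N (RUNG; theorem-grade by pure descent, census 17 612 place rows / 0 exceptions).** THE SIMPLE NODAL PRIMES.  For the
untwisted normal-form pair `E = E_f`, `F = E′_f` and an odd prime `p ∣ c` with `p ∤ b·Δ_f` (`E` has good reduction at `p`; `E′_f` reduces to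
the node `y² = x²(x + b)`, type `I_{2 v_p(c)}`, split iff `b ∈ 𝔽_p^{×2}`): the local parity symbol is ODD iff `v_p(c)` is odd or the node
is split — i.e. `(−1)^{κ_p} = −(b/p)^{v_p(c)+1}`, which is DESC-§21-G at these primes (`𝓔_p(f) = (b/p)^{v_p(c)}`, `w_p(E) = 1`,
`w_p(E′_f) = −(b/p)`) but involves neither root numbers nor Hilbert symbols: it is a statement about the position of the Kummer image of a
Tate curve against the unramified Lagrangian plus the conic correction bit, provable from the local norm-index computations.  DERIVATION N ⟸ G (REF1 §83 rider g4, (α)): at odd `p ∣ c`, `p ∤ b·Δ_f`: `w_p(E_f) = 1`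
(good, `Δ_E = 16Δ_f`), `w_p(E′_f) = −(b/p)` (node split iff `b ∈ 𝔽_p^{×2}`), `(−1,−1)_p = 1`, and `𝓔_p(f) = (b/p)^{v_p(c)}` in BOTH sub-cases
— `p ∤ a`: `v_p(L) = v_p(ab − 9c) = 0`, only `(b,−c)_p = (b/p)^{v_p(c)}` survives; `p ∣ a`: `L ≡ 0` but `(−2L,Δ_f)_p (L,−b)_p =
((−bΔ_f)/p)^{v_p(L)}` with `−bΔ_f ≡ 4b⁴` a square mod `p`, so `= 1` — hence `(−1)^{κ_p} = −(b/p)^{v_p(c)+1}`, i.e. `Odd κ_p ↔ Odd v_p(c) ∨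
(b/p) = 1`: no Hilbert symbol survives.  REF1-AUDIT §83: SURVIVES theorem-candidate, CLEARED (= G at `d = 1` on the simple nodal primes EXACTLY);
REF2 v19 §2: theorem-candidate on printed ingredients (Kramer 1981 Props 1, 2, 7; Tate-curve Kummer theory), VARIANT — the right first rung.
[cite: Kramer1981, Props. 1, 2, 7] [cite: GreenMaistret2022, Def. 2.8] -/
def CongruenceParityAtNodalPrimeAtTwo : Prop :=
  ∀ (a b c : ℤ), c ≠ 0 → gmDisc a b c ≠ 0 →
    ∀ [Fact (Irreducible (twoDivisionUCubic (gmCurve a b c)))] [Fact (Irreducible (twoDivisionUCubic (gmPartner a b c)))]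
      (ψ : twoDivisionAlgebra (gmPartner a b c) →ₐ[ℚ] twoDivisionAlgebra (gmCurve a b c)),
      ψ (twoDivisionRoot (gmPartner a b c)) * twoDivisionRoot (gmCurve a b c) =
        algebraMap ℚ (twoDivisionAlgebra (gmCurve a b c)) (16 * c : ℚ) →
    ∀ (p : ℕ) [Fact p.Prime], p ≠ 2 → (p : ℤ) ∣ c → ¬ (p : ℤ) ∣ b → ¬ (p : ℤ) ∣ gmDisc a b c →
    ∀ (dp cp : ℕ),
      IsLocalParitySymbolAt (gmCurve a b c) ℚ_[p] (InExplicitLocalKummerImageAtTwo (gmCurve a b c) p)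
        (InTransportedKummerImageAtTwo (gmCurve a b c) (gmPartner a b c) ψ p)
        (thetaDiscrepancyAtTwo (gmCurve a b c) (gmPartner a b c) ψ) dp cp →
      (Odd (dp + cp) ↔ (Odd (padicValInt p c) ∨ IsSquare ((b : ℤ) : ZMod p)))

/-- **DESC-§21-D (support, theorem-grade, elementary).** Two curves with isomorphic irreducible cubic `2`-division algebras have
discriminants in the same rational square class (`disc c_W = 2⁸·Δ_W` EXACTLY for `c_W = twoDivisionUCubic W` — REF1 §83 d1 — and isomorphic
cubic fields have polynomial discriminants differing by a square).  Used in §20/§21 to see `N(u_{E,F}) ∈ ℚ^{×2}`.  REF1-AUDIT §83: TRUE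
(elementary), CLEARED as support; REF2 v19 §2: KNOWN, folklore. **PROVED** (typer g8, 2026-08-28, p619435): `discProductSquareOfTwoCongruence_holds` in the
sibling module `F1Sign2/CongruenceLocalGaugeAtTwoProofs.lean` (`N(c_W′(θ_W)) = −2⁸Δ_W`, `disc(1, θ_W, θ_W²) = 2⁸Δ_W`, discriminant invariance along
the algebra isomorphism and `det²` under base change). [folklore] -/
def DiscProductSquareOfTwoCongruence : Prop :=
  ∀ (E F : WeierstrassCurve ℚ) [Fact (Irreducible (twoDivisionUCubic E))] [Fact (Irreducible (twoDivisionUCubic F))],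
    Nonempty (twoDivisionAlgebra F ≃ₐ[ℚ] twoDivisionAlgebra E) → IsSquare (E.Δ * F.Δ)

/-! ## Support (PROVED; REF1-AUDIT §83 rider g3): the normal form against the tree's carriers, and non-vacuity of the pin

Verbatim from REF1's kernel-clean probe `HOME/REF1-data/b83/Probe83.lean` cf126a14c971e026 l.137–197 (audit lemmas e1–e3; farm rc 0, axioms
{propext, Classical.choice, Quot.sound}); docstrings added by the typer, the probe's `example`s omitted. These are theorems about the NEW carriers of
this file only (no Literature import beyond the sketch's). -/

section Support

variable (a b c d : ℤ)

/-- `b₂(E_f) = 4a`. -/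
theorem gm_b₂ : (gmCurve a b c).b₂ = 4 * (a : ℚ) := by simp [gmCurve, WeierstrassCurve.b₂]
/-- `b₄(E_f) = 2b`. -/
theorem gm_b₄ : (gmCurve a b c).b₄ = 2 * (b : ℚ) := by simp [gmCurve, WeierstrassCurve.b₄]
/-- `b₆(E_f) = 4c`. -/
theorem gm_b₆ : (gmCurve a b c).b₆ = 4 * (c : ℚ) := by simp [gmCurve, WeierstrassCurve.b₆]
/-- `b₂(E′_f) = 4b`. -/
theorem gmP_b₂ : (gmPartner a b c).b₂ = 4 * (b : ℚ) := by simp [gmPartner, WeierstrassCurve.b₂]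
/-- `b₄(E′_f) = 2ac`. -/
theorem gmP_b₄ : (gmPartner a b c).b₄ = 2 * ((a : ℚ) * c) := by simp [gmPartner, WeierstrassCurve.b₄]
/-- `b₆(E′_f) = 4c²`. -/
theorem gmP_b₆ : (gmPartner a b c).b₆ = 4 * (c : ℚ) ^ 2 := by simp [gmPartner, WeierstrassCurve.b₆]

/-- REF1 §83 e1: the `u`-cubic of `E_f` is `u³ + 4a u² + 16b u + 64c = 64·f(u/4)` — roots `θᵢ = 4αᵢ`, as the docstring of
`IsGMCongruence` says. -/
theorem cubic_gmCurve :
    twoDivisionUCubic (gmCurve a b c) = X ^ 3 + C (4 * (a : ℚ)) * X ^ 2 + C (8 * (2 * (b : ℚ))) * X + C (16 * (4 * (c : ℚ))) := by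
  rw [twoDivisionUCubic, gm_b₂, gm_b₄, gm_b₆]

/-- REF1 §83 e2: the `u`-cubic of `(E′_f)^{(d)}` is `u³ + 4db u² + 16d²ac u + 64 d³c²` — roots `4dc/αᵢ = 16cd/θᵢ` (the tree's
`quadraticTwist` scales the completed-square model: `⟨0, d·b₂/4, 0, d²·b₄/2, d³·b₆/4⟩ = ⟨0, db, 0, d²ac, d³c²⟩`, = -desc engine6's partner). -/
theorem cubic_twist_gmPartner :
    twoDivisionUCubic ((gmPartner a b c).quadraticTwist (d : ℚ)) =
      X ^ 3 + C ((d : ℚ) * (4 * (b : ℚ))) * X ^ 2 + C (8 * ((d : ℚ) ^ 2 * (2 * ((a : ℚ) * c)))) * X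
        + C (16 * ((d : ℚ) ^ 3 * (4 * (c : ℚ) ^ 2))) := by
  rw [twoDivisionUCubic_quadraticTwist, gmP_b₂, gmP_b₄, gmP_b₆]

/-- **NON-VACUITY OF THE PIN (REF1-AUDIT §83 e3, rider g3; A3).** The normal-form congruence EXISTS for all `a b c d : ℤ` (stated, like
the tree's `exists_algHom_twist_twoDivisionRoot`, without the `Fact (Irreducible _)` binders so that `aeval` sees the `AdjoinRoot` algebra
structure): `ψ(θ_F) := η = −(d/4)(θ_E² + 4aθ_E + 16b)` (`= 16cd/θ_E` by the cubic relation) is a root of the partner-twist cubic in `L_E`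
(polynomial identity `c_F(η(X)) = c_E(X)·Q(X)`, certificate `HOME/REF1-data/b83/polycheck.py`, `lincomb.py`), and `η·θ_E = 16cd`.  When `c_E` is
irreducible `θ_E` is a unit of the field `L_E`, so `ψ(θ_F) = 16cd·θ_E⁻¹` is forced and the pin DETERMINES `ψ` (S₃ and C₃ fields alike). -/
theorem exists_isGMCongruence : ∃ ψ, IsGMCongruence a b c d ψ := by
  have h0 : aeval (twoDivisionRoot (gmCurve a b c))
      (X ^ 3 + C (4 * (a : ℚ)) * X ^ 2 + C (8 * (2 * (b : ℚ))) * X + C (16 * (4 * (c : ℚ))) : ℚ[X]) = 0 := by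
    rw [← cubic_gmCurve]; exact aeval_twoDivisionRoot_twoDivisionUCubic _
  simp only [map_add, map_mul, map_pow, map_ofNat, aeval_C, aeval_X] at h0
  have hq : (4 : twoDivisionAlgebra (gmCurve a b c)) * algebraMap ℚ (twoDivisionAlgebra (gmCurve a b c)) (1 / 4 : ℚ) = 1 := by
    rw [← map_ofNat (algebraMap ℚ (twoDivisionAlgebra (gmCurve a b c))) 4, ← map_mul, ← map_one (algebraMap ℚ _)]
    norm_num
  set θ := twoDivisionRoot (gmCurve a b c) with hθ
  set q := algebraMap ℚ (twoDivisionAlgebra (gmCurve a b c)) (1 / 4 : ℚ) with hqdef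
  set A := algebraMap ℚ (twoDivisionAlgebra (gmCurve a b c)) (a : ℚ) with hA
  set B := algebraMap ℚ (twoDivisionAlgebra (gmCurve a b c)) (b : ℚ) with hB
  set Cc := algebraMap ℚ (twoDivisionAlgebra (gmCurve a b c)) (c : ℚ) with hC
  set D := algebraMap ℚ (twoDivisionAlgebra (gmCurve a b c)) (d : ℚ) with hD
  let η : twoDivisionAlgebra (gmCurve a b c) := -(D * q) * (θ ^ 2 + 4 * A * θ + 16 * B)
  have hroot : aeval η (twoDivisionUCubic ((gmPartner a b c).quadraticTwist (d : ℚ))) = 0 := by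
    rw [cubic_twist_gmPartner]
    simp only [map_add, map_mul, map_pow, map_ofNat, aeval_C, aeval_X]
    rw [← hA, ← hB, ← hC, ← hD]
    linear_combination (-(D ^ 3 * q ^ 3) * (θ ^ 3 + 8 * A * θ ^ 2 + (16 * A ^ 2 + 16 * B) * θ + 64 * A * B - 64 * Cc)) * h0
      + (D ^ 3 * (-64 * Cc ^ 2 - 256 * Cc ^ 2 * q - 1024 * Cc ^ 2 * q ^ 2 - 1024 * B ^ 3 * q ^ 2 + 256 * A * B * Cc * q
          + 1024 * A * B * Cc * q ^ 2 - 512 * θ * A * B ^ 2 * q ^ 2 + 64 * θ * A ^ 2 * Cc * q + 256 * θ * A ^ 2 * Cc * q ^ 2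
          - 128 * θ ^ 2 * B ^ 2 * q ^ 2 + 16 * θ ^ 2 * A * Cc * q + 64 * θ ^ 2 * A * Cc * q ^ 2 - 64 * θ ^ 2 * A ^ 2 * B * q ^ 2
          - 32 * θ ^ 3 * A * B * q ^ 2 - 4 * θ ^ 4 * B * q ^ 2)) * hq
  refine ⟨AdjoinRoot.liftAlgHom _ (Algebra.ofId ℚ _) η (by simpa [Polynomial.aeval_def] using hroot), ?_⟩
  unfold IsGMCongruence
  have hψ : (AdjoinRoot.liftAlgHom _ (Algebra.ofId ℚ _) η (by simpa [Polynomial.aeval_def] using hroot))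
      (twoDivisionRoot ((gmPartner a b c).quadraticTwist (d : ℚ))) = η := by
    simp [twoDivisionRoot]
  rw [hψ]
  simp only [map_mul, map_ofNat]
  rw [← hC, ← hD, ← hθ]
  linear_combination (-(D * q)) * h0 + (16 * Cc * D) * hq

end Support

end Summit.BirchSwinnertonDyer.Rank1Residual.F1Sign2
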